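import Summits.CriticalPhenomena.PercolationContinuityZ3.Theorems.Transplant.FKThreeApexRigid
import Summits.CriticalPhenomena.PercolationContinuityZ3.Theorems.Transplant.FKThreeApexT4
import HarnessLib

/-!
# Connectivity correlation inequalities for `φ_{w,q}` — the three-apex family: PINNED LETTERS and the Rayleigh differences of types T1, T4, T6

Support file (`--supports stmt-CriticalPhenomena-4575`), FK sub-lane `prim-bschramm-fk-3` (gen 12); builds on p205010 (kernel theorem, internal audit
signed; external expert review pending).  Pure algebra; no named facts, no sorries; standard axioms.  Layer 3a of the `K_{1,1,1,n}` programme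
(memo `bschramm/prim-bschramm-fk-3/THREE-APEX.md` §6): letters COMMUTE (`conv_comm`), so a marked leaf / triangle edge can be moved to the end of the
product; pinning its marked edge(s) open/closed gives the letters `leaf q 1 · ·`, `leaf q 0 · ·`, `edgeAB 1`, `edgeAB 0`, …, and the Rayleigh
difference `Z¹⁰Z⁰¹ − Z¹¹Z⁰⁰` of the four pinned partition functions (each a `val` of the product, by `rcPartitionFunctionW_eq_transfer3`) is EXACTLY
the form of the algebra layer evaluated at the vector `R` of the remaining letters: **`rayleigh_T1_eq`** (`= t1Form q c R`), **`rayleigh_T4_eq`**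
(`= t4Form q b c R`), **`rayleigh_T6_eq`** (`= q²(1−q)·N^{(ac)}(R)`).  With `InK.t1Form_nonneg`, `InK.t4Form_nonneg`, `InK.masterN_nonneg` these are
`≥ 0` on the three-apex monoid (`rayleigh_T1_nonneg`, …) — the algebraic content of "adjacent edges of `K_{1,1,1,n}` are negatively correlated".
[cite: Grimmett2006, §3.9 eq. (3.94) (pp. 63–64)] [folklore]
-/

noncomputable section

namespace Summit.CriticalPhenomena.PercolationContinuityZ3.Theorems

namespace FK

namespace ThreeApex

/-- **Letters commute** (the monoid algebra of the join-semilattice `Π₃` is commutative). [folklore] -/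
theorem conv_comm (z z' Z : V5) : conv z (conv z' Z) = conv z' (conv z Z) := by
  ext <;> simp only [conv, V5.total] <;> ring

/-- The closed triangle edge acts as the identity. [folklore] -/
theorem conv_edgeAB_zero (Z : V5) : conv (edgeAB 0) Z = Z := by
  ext <;> simp [conv, edgeAB, V5.total]

/-- The closed triangle edge `bc` acts as the identity. [folklore] -/
theorem conv_edgeBC_zero (Z : V5) : conv (edgeBC 0) Z = Z := by
  ext <;> simp [conv, edgeBC, V5.total]

/-- **Type T1** (the two edges `u a`, `u b` at a leaf `u` with third edge probability `c`): the Rayleigh difference of the four pinned valuations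
is the T1 form. [folklore] -/
theorem rayleigh_T1_eq (q c : ℝ) (R : V5) :
    val q (conv (leaf q 1 0 c) R) * val q (conv (leaf q 0 1 c) R) - val q (conv (leaf q 1 1 c) R) * val q (conv (leaf q 0 0 c) R) =
      t1Form q c R := by
  simp only [val, conv, leaf, t1Form, V5.total]
  ring

/-- **Type T4** (the leaf edge `u a`, leaf with remaining probabilities `b, c`, against the triangle edge `ab`). [folklore] -/
theorem rayleigh_T4_eq (q b c : ℝ) (R : V5) :
    val q (conv (leaf q 1 b c) (conv (edgeAB 0) R)) * val q (conv (leaf q 0 b c) (conv (edgeAB 1) R)) -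
        val q (conv (leaf q 1 b c) (conv (edgeAB 1) R)) * val q (conv (leaf q 0 b c) (conv (edgeAB 0) R)) =
      t4Form q b c R := by
  simp only [val, conv, leaf, edgeAB, t4Form, T4.c_oo, T4.c_oab, T4.c_oac, T4.c_obc, T4.c_ot, T4.c_abac, T4.c_abbc, T4.c_acac, T4.c_acbc,
    T4.c_act, T4.c_bcbc, T4.c_bct, V5.total]
  ring

/-- **Type T6** (the triangle edges `ab`, `bc`): the Rayleigh difference is `q²(1−q)·N^{(ac)}`. [folklore] -/
theorem rayleigh_T6_eq (q : ℝ) (R : V5) :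
    val q (conv (edgeAB 1) (conv (edgeBC 0) R)) * val q (conv (edgeAB 0) (conv (edgeBC 1) R)) -
        val q (conv (edgeAB 1) (conv (edgeBC 1) R)) * val q (conv (edgeAB 0) (conv (edgeBC 0) R)) =
      q ^ 2 * (1 - q) * masterN q R := by
  simp only [val, conv, edgeAB, edgeBC, masterN, V5.total]
  ring

/-- T1 on the monoid: the pinned Rayleigh difference is `≥ 0` (`0 ≤ q ≤ 1`, `0 ≤ c ≤ 1`). [folklore] -/
theorem rayleigh_T1_nonneg {q c : ℝ} (hq0 : 0 ≤ q) (hq1 : q ≤ 1) (hc0 : 0 ≤ c) (hc1 : c ≤ 1) {R : V5} (hR : InK q R) :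
    0 ≤ val q (conv (leaf q 1 0 c) R) * val q (conv (leaf q 0 1 c) R) - val q (conv (leaf q 1 1 c) R) * val q (conv (leaf q 0 0 c) R) := by
  rw [rayleigh_T1_eq]; exact hR.t1Form_nonneg hq0 hq1 hc0 hc1

/-- T4 on the monoid. [folklore] -/
theorem rayleigh_T4_nonneg {q b c : ℝ} (hq0 : 0 ≤ q) (hq1 : q ≤ 1) (hb0 : 0 ≤ b) (hb1 : b ≤ 1) (hc0 : 0 ≤ c) (hc1 : c ≤ 1) {R : V5}
    (hR : InK q R) :
    0 ≤ val q (conv (leaf q 1 b c) (conv (edgeAB 0) R)) * val q (conv (leaf q 0 b c) (conv (edgeAB 1) R)) -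
        val q (conv (leaf q 1 b c) (conv (edgeAB 1) R)) * val q (conv (leaf q 0 b c) (conv (edgeAB 0) R)) := by
  rw [rayleigh_T4_eq]; exact hR.t4Form_nonneg hq0 hq1 hb0 hb1 hc0 hc1

/-- T6 on the monoid. [folklore] -/
theorem rayleigh_T6_nonneg {q : ℝ} (hq0 : 0 ≤ q) (hq1 : q ≤ 1) {R : V5} (hR : InK q R) :
    0 ≤ val q (conv (edgeAB 1) (conv (edgeBC 0) R)) * val q (conv (edgeAB 0) (conv (edgeBC 1) R)) -
        val q (conv (edgeAB 1) (conv (edgeBC 1) R)) * val q (conv (edgeAB 0) (conv (edgeBC 0) R)) := by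
  rw [rayleigh_T6_eq]
  have := hR.masterN_nonneg hq0 hq1
  have hq' : (0 : ℝ) ≤ 1 - q := sub_nonneg.2 hq1
  positivity

end ThreeApex

end FK

end Summit.CriticalPhenomena.PercolationContinuityZ3.Theorems
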